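import Literature.Probability.RandomPlanarGeometry.USTPeanoTreeBijection
import Literature.Probability.RandomPlanarGeometry.LSW2004USTPeanoExistence
import Literature.Probability.LatticeModels.WilsonAlgorithm
import HarnessLib

/-!
# The UST Peano path law as the uniform spanning tree ([LSW04] §4.1), and "by Wilson's algorithm"

G. F. Lawler, O. Schramm, W. Werner, Ann. Probab. **32** (2004), §4.1, p. 972: "Conversely, it is
easy to see that `T ↦ γ(T)` is a bijection between the set of spanning trees of `H` containing
`α` and the set of oriented paths in `G⃗ ∩ D̄` from `a` to `b` containing `V_P`. Hence, when `T` is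
the UST on `H` conditioned to contain `α`, `γ` is uniformly distributed among such Peano paths",
and proof of Theorem 4.4, p. 975: "Let `A` be the event that the path in the tree `T(γ)` from
`v₀` to `α` hits `A′₁`. […] By Wilson's algorithm, `P[A]` is the probability that a simple random
walk on the graph `H(∂D)` started at `v₀` stopped on hitting `α` will cross `A′₁`."

This file packages the combinatorial bijection `PeelData.Good.pathForestEquiv`
(`USTPeanoTreeBijection.lean`) at the level of a domain `D ∈ 𝔇*`:

* `PeanoPath.isPath_verts`, `Domain.peanoPathEquiv` — the Peano paths of `D` (`USTPeanoPath.lean`: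
  edges avoiding the point set `α ∪ β`) are exactly the combinatorial Peano paths of its peeling
  data (`USTPeanoPeeling.lean`: edges not blocked); the converse of `Domain.peanoPath` uses that
  the step `p → stepP p` meets the primal edge `f₁(p)` (in `midP p`) and `p → stepD p` meets the
  dual edge it crosses;
* `Domain.peanoForestEquiv : PeanoPath D ≃ Forest D.treeGraph D.treeRoots` — `T ↦ γ(T)`⁻¹, and
  `Domain.tEdge_peanoForestEquiv_iff` — its edges off `α` are the primal edges alongside the dual
  steps of `γ` (`T(γ) = α_{ℓ+1}`);
* `Domain.ustLaw_preimage_peanoForestEquiv`, `Domain.map_peanoForestEquiv_ustLaw` — the UST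
  Peano path law `ustLaw D` (uniform on Peano paths) is the uniform spanning tree of `H` with
  wired boundary `α` (`Forest.ust`, `WilsonAlgorithm.lean`) transported along the bijection;
* `Domain.ustLaw_br_pred_eq`, `Domain.ustLaw_br_endsWith_eq` — **"by Wilson's algorithm"**: under
  `ustLaw D` the branch of `T(γ)` from a vertex `v` to `α` is distributed as the loop erasure of
  simple random walk on `H` from `v` stopped at `α`; in particular the probability that it
  enters `α` through a given edge is the corresponding random-walk probability (Pemantle's
  theorem `Forest.ust_br_eq` / `Forest.ust_br_endsWith_eq` pulled back to Peano paths).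

## References

* G. F. Lawler, O. Schramm, W. Werner, *Conformal invariance of planar loop-erased random walks
  and uniform spanning trees*, Ann. Probab. **32** (2004), §4.1 and proof of Thm. 4.4.
  [LawlerSchrammWerner2004]
* R. Lyons, Y. Peres, *Probability on Trees and Networks*, CUP (2016), §4.1, Cor. 4.3.
  [LyonsPeres2016]
-/

noncomputable section

open scoped ENNReal Classical
open MeasureTheory ProbabilityTheory
open Literature.Probability.LatticeModels
open Literature.Probability.LatticeModels.StoppedWalk

namespace Literature.Probability.LatticeModels

open Literature.Probability.RandomPlanarGeometry

namespace Forest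

variable {V : Type*} [Fintype V] [DecidableEq V] {H : SimpleGraph V} {R : Finset V}

omit [Fintype V] [DecidableEq V] in
/-- A chain of adjacent vertices joins its endpoints in the graph. [folklore] -/
theorem reachable_getLast_of_isChain {l : List V} (h : List.IsChain H.Adj l) (hl : l ≠ []) :
    H.Reachable (l.head hl) (l.getLast hl) := by
  induction l with
  | nil => exact absurd rfl hl
  | cons a t ih =>
    cases t with
    | nil => exact SimpleGraph.Reachable.refl _
    | cons b t' =>
      obtain ⟨hab, ht⟩ := List.isChain_cons_cons.1 h
      have := ih ht (List.cons_ne_nil _ _)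
      rw [List.head_cons] at this
      rw [List.head_cons, List.getLast_cons (List.cons_ne_nil _ _)]
      exact hab.reachable.trans this

/-- **If there is a rooted spanning forest, every vertex is joined to the root set** (along its
branch). [folklore] -/
theorem reachesRoot_of_forest (F : Forest H R) : ReachesRoot H R := by
  intro x hx
  have hst := F.isStoppedAt_br hx
  refine ⟨(x :: F.br x).getLast (List.cons_ne_nil _ _), hst.getLast_mem, ?_⟩
  have := reachable_getLast_of_isChain (F.isChain_br hx) (List.cons_ne_nil _ _)
  rwa [List.head_cons] at this

variable [DecidableRel H.Adj]

/-- **Pemantle's theorem, push-forward form (measure version)**: under the uniform spanning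
forest rooted at `R`, for any property `P` of paths, the probability that the branch from
`v ∉ R` satisfies `P` is the simple-random-walk mass of the walks from `v` stopped at `R` whose
loop erasure satisfies `P`. [cite: LyonsPeres2016, Corollary 4.3] -/
theorem ust_br_pred_eq (h : ReachesRoot H R) {v : V} (hv : v ∉ R) (P : List V → Prop) :
    ust H R {F | P (F.br v)} =
      wsum (srw H) v (fun t => IsStoppedAt (↑R : Set V) (v :: t) ∧
        P (loopErase (afterLast v t))) := by
  rw [ust, ProbabilityTheory.uniformOn_univ, Measure.count_apply_finite _ (Set.toFinite _)]
  have hcard : ((Set.toFinite {F : Forest H R | P (F.br v)}).toFinset.card : ℝ≥0∞) =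
      ((Finset.univ.filter fun F : Forest H R => P (F.br v)).card : ℝ≥0∞) := by
    congr 2
    ext F
    simp
  rw [hcard, card_filter_br_pred_eq h hv P, mul_comm, mul_div_assoc,
    ENNReal.div_self (by exact_mod_cast (card_pos h).ne') (ENNReal.natCast_ne_top _), mul_one]

end Forest

end Literature.Probability.LatticeModels

namespace Literature.Probability.RandomPlanarGeometry

namespace USTPeano

/-! ### Uniform measures along equivalences -/

/-- **The uniform measure is transported along an equivalence of finite types.** [folklore] -/
theorem uniformOn_univ_preimage_equiv {X Y : Type*} [MeasurableSpace X]
    [MeasurableSingletonClass X] [Fintype X] [MeasurableSpace Y] [MeasurableSingletonClass Y]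
    [Fintype Y] (e : X ≃ Y) (A : Set Y) :
    uniformOn Set.univ (e ⁻¹' A) = uniformOn Set.univ A := by
  have hA : e ⁻¹' A = e.symm '' A := by rw [Equiv.image_eq_preimage_symm, Equiv.symm_symm]
  rw [uniformOn_univ, uniformOn_univ, Fintype.card_congr e, hA,
    Measure.count_injective_image e.symm.injective]

/-- The push-forward of the uniform measure along an equivalence of finite types is the uniform
measure. [folklore] -/
theorem map_equiv_uniformOn_univ {X Y : Type*} [MeasurableSpace X]
    [MeasurableSingletonClass X] [Fintype X] [MeasurableSpace Y] [MeasurableSingletonClass Y]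
    [Fintype Y] (e : X ≃ Y) (he : Measurable e) :
    (uniformOn Set.univ : Measure X).map e = uniformOn Set.univ := by
  ext A hA
  rw [Measure.map_apply he hA, uniformOn_univ_preimage_equiv]

/-! ### The two Manhattan steps meet the lattice edges they cross -/

/-- The midpoint of the primal step `p → stepP p` lies on that closed edge. [folklore] -/
theorem midP_mem_segment_stepP (p : ℤ × ℤ) :
    midP p ∈ segment ℝ (peanoPt p) (peanoPt (stepP p)) :=
  mem_segment_of_eq (b := 1 / 2) (by norm_num) (by norm_num) (by simp only [midP]; ring)
    (by simp only [midP]; ring)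

/-- **The primal step crosses `f₁`**: the midpoint of `p → stepP p` lies on the primal edge
`f₁(p) = [primalNbr p, farP p]` (a quarter of the way from `primalNbr p`). [folklore] -/
theorem midP_mem_primalEdge (p : ℤ × ℤ) :
    midP p ∈ segment ℝ (primalPt (primalNbr p)) (primalPt (farP p)) := by
  obtain ⟨m, n, rfl | rfl | rfl | rfl⟩ := parity_cases p
  · rw [midP_ee, primalNbr_ee, farP_ee]
    exact mem_segment_of_eq (b := 1 / 4) (by norm_num) (by norm_num)
      (by simp only [primalPt_re, Int.cast_add, Int.cast_one]; ring) (by simp only [primalPt_im]; ring)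
  · rw [midP_eo, primalNbr_eo, farP_eo]
    exact mem_segment_of_eq (b := 1 / 4) (by norm_num) (by norm_num)
      (by simp only [primalPt_re]; ring) (by simp only [primalPt_im, Int.cast_add, Int.cast_one]; ring)
  · rw [midP_oe, primalNbr_oe, farP_oe]
    exact mem_segment_of_eq (b := 1 / 4) (by norm_num) (by norm_num)
      (by simp only [primalPt_re, Int.cast_add, Int.cast_one]; ring)
      (by simp only [primalPt_im, Int.cast_add, Int.cast_one]; ring)
  · rw [midP_oo, primalNbr_oo, farP_oo]
    exact mem_segment_of_eq (b := 1 / 4) (by norm_num) (by norm_num)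
      (by simp only [primalPt_re, Int.cast_add, Int.cast_one]; ring)
      (by simp only [primalPt_im, Int.cast_add, Int.cast_one]; ring)

/-- **The dual step crosses the dual edge `[dualNbr p, farD p]`**: the two closed segments meet
(by the reflection `swapC` exchanging the primal and the dual grid). [folklore] -/
theorem exists_mem_segment_stepD_dualEdge (p : ℤ × ℤ) :
    ∃ z, z ∈ segment ℝ (peanoPt p) (peanoPt (stepD p)) ∧
      z ∈ segment ℝ (dualPt (dualNbr p)) (dualPt (farD p)) := by
  refine ⟨swapC (midP (swapIdx p)), ?_, ?_⟩
  · have h := swapC_mem_segment (midP_mem_segment_stepP (swapIdx p))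
    rwa [stepP_swapIdx, swapC_peanoPt, swapC_peanoPt, swapIdx_swapIdx, swapIdx_swapIdx] at h
  · have h := swapC_mem_segment (midP_mem_primalEdge (swapIdx p))
    rwa [primalNbr_swapIdx, farP_swapIdx, swapC_primalPt, swapC_primalPt, swapIdx_swapIdx,
      swapIdx_swapIdx] at h

/-- Segments with endpoints given as an unordered pair. [folklore] -/
theorem segment_eq_of_sym2_eq {f : ℤ × ℤ → ℂ} {u v u' v' : ℤ × ℤ} (h : s(u, v) = s(u', v')) :
    segment ℝ (f u) (f v) = segment ℝ (f u') (f v') := by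
  rcases Sym2.eq_iff.1 h with ⟨rfl, rfl⟩ | ⟨rfl, rfl⟩
  · rfl
  · exact segment_symm ℝ _ _

/-! ### Peano paths of the domain are the combinatorial Peano paths of its peeling data -/

namespace PeanoPath

variable {D : Domain}

/-- **The edges of a Peano path of `D` are not blocked**: an edge of `G⃗` crossing an edge of `α`
(resp. `β`) meets the point set `α` (resp. `β`), which the edges of a Peano path avoid.
[cite: LawlerSchrammWerner2004, §4.1] -/
theorem not_blocked (γ : PeanoPath D) {e : (ℤ × ℤ) × (ℤ × ℤ)} (he : e ∈ γ.verts.zip γ.verts.tail) :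
    ¬ D.peelData.Blocked e.1 e.2 := by
  rintro (⟨hq, hmem⟩ | ⟨hq, hmem⟩)
  · obtain ⟨e', he', hee⟩ := mem_edgeSet_iff.1 hmem
    have h1 : midP e.1 ∈ segment ℝ (peanoPt e.1) (peanoPt e.2) := by
      rw [hq]; exact midP_mem_segment_stepP e.1
    refine Set.disjoint_left.1 (γ.disjoint_edge e he) h1 (Or.inl (Or.inr ?_))
    refine Set.mem_iUnion₂.2 ⟨e', he', ?_⟩
    rw [segment_eq_of_sym2_eq (f := primalPt) hee]
    exact midP_mem_primalEdge e.1
  · obtain ⟨f', hf', hff⟩ := mem_edgeSet_iff.1 hmem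
    obtain ⟨z, hz1, hz2⟩ := exists_mem_segment_stepD_dualEdge e.1
    have h1 : z ∈ segment ℝ (peanoPt e.1) (peanoPt e.2) := by rw [hq]; exact hz1
    refine Set.disjoint_left.1 (γ.disjoint_edge e he) h1 (Or.inr (Or.inr ?_))
    refine Set.mem_iUnion₂.2 ⟨f', hf', ?_⟩
    rw [segment_eq_of_sym2_eq (f := dualPt) hff]
    exact hz2

/-- **A Peano path of `D` is a combinatorial Peano path of its peeling data** (the converse of
`Domain.peanoPath`). [cite: LawlerSchrammWerner2004, §4.1] -/
theorem isPath_verts (γ : PeanoPath D) : D.peelData.IsPath γ.verts where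
  ne_nil := γ.ne_nil
  head_eq := γ.head_eq
  getLast_eq := γ.getLast_eq
  isChain := γ.isChain
  nodup := γ.nodup
  mem_iff p := by rw [γ.mem_iff p, Domain.mem_peelData_V, Domain.mem_peanoVerts]; rfl
  unblocked _ he := γ.not_blocked he

/-- Every set of Peano paths is measurable (discrete σ-algebra). [folklore] -/
instance instMeasurableSingletonClass : MeasurableSingletonClass (PeanoPath D) :=
  ⟨fun _ ↦ trivial⟩

end PeanoPath

namespace PeelData

variable {P₀ : Finset (ℤ × ℤ)} {S : PeelData}

/-- For good data every vertex of `H(S)` off the roots is joined to the roots (along the tree of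
any Peano path). [folklore] -/
theorem Good.reachesRoot (h : S.Good) (hP : S.amb ⊆ P₀) :
    Forest.ReachesRoot (S.primalGraph P₀) (S.roots P₀) :=
  let ⟨_, hl⟩ := h.exists_isPath
  Forest.reachesRoot_of_forest (Good.pathForestEquiv S h hP ⟨_, hl⟩)

/-- **"By Wilson's algorithm", counting form for peeling data**: among the Peano paths of good
data `S`, those whose tree `T(γ)` has a branch from `v ∉ roots` satisfying `P` number
`#paths · (simple-random-walk mass of the walks on H(S) from v stopped at the roots whose loop
erasure satisfies P)` — the bijection `T` composed with Pemantle's theorem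
(`Forest.card_filter_br_pred_eq`). This is the form used after conditioning on a prefix (the
peeled data `S.peelAlong …` are not a domain). [cite: LawlerSchrammWerner2004, Theorem 4.4 (proof, p. 975)] -/
theorem Good.card_isPath_br_pred_eq (h : S.Good) (hP : S.amb ⊆ P₀) {v : ↥P₀} (hv : v ∉ S.roots P₀)
    (P : List ↥P₀ → Prop) :
    (Nat.card {γ : {l // S.IsPath l} // P ((Good.pathForestEquiv S h hP γ).br v)} : ℝ≥0∞) =
      Nat.card {l // S.IsPath l} *
        wsum (Forest.srw (S.primalGraph P₀)) v (fun t => IsStoppedAt (↑(S.roots P₀) : Set ↥P₀) (v :: t) ∧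
          P (loopErase (afterLast v t))) := by
  set e := Good.pathForestEquiv S h hP
  have h1 : Nat.card {γ : {l // S.IsPath l} // P ((e γ).br v)} =
      Nat.card {F : Forest (S.primalGraph P₀) (S.roots P₀) // P (F.br v)} :=
    Nat.card_congr (e.subtypeEquiv fun _ ↦ Iff.rfl)
  rw [h1, Nat.card_congr e, Nat.card_eq_fintype_card, Nat.card_eq_fintype_card, Fintype.card_subtype]
  exact Forest.card_filter_br_pred_eq (h.reachesRoot hP) hv P

end PeelData

namespace Domain

variable (D : Domain)

/-- **Peano paths of `D` ≃ combinatorial Peano paths of its peeling data** (same vertex lists).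
[cite: LawlerSchrammWerner2004, §4.1] -/
def peanoPathEquiv : PeanoPath D ≃ {l // D.peelData.IsPath l} where
  toFun γ := ⟨γ.verts, γ.isPath_verts⟩
  invFun l := D.peanoPath l.2
  left_inv _ := PeanoPath.verts_injective rfl
  right_inv _ := rfl

/-- The equivalence is the vertex list. [folklore] -/
@[simp] theorem peanoPathEquiv_apply_val (γ : PeanoPath D) : (D.peanoPathEquiv γ).1 = γ.verts := rfl

/-- The inverse equivalence keeps the vertex list. [folklore] -/
@[simp] theorem verts_peanoPathEquiv_symm (l : {l // D.peelData.IsPath l}) :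
    (D.peanoPathEquiv.symm l).verts = l.1 := rfl

/-- **The graph `H = H(D)`** of [LSW04] §4.1 on the finite vertex type of the ambient primal
indices of `D`: the primal edges alongside the available dual steps (the edges a spanning tree
containing `α` may use off `α`; `PeelData.primalGraph`). [cite: LawlerSchrammWerner2004, §4.1] -/
abbrev treeGraph : SimpleGraph ↥D.peelData.amb := D.peelData.primalGraph D.peelData.amb

/-- **The wired root set**: the vertices of `α` (and the isolated padding vertices).
[cite: LawlerSchrammWerner2004, §4.1] -/
abbrev treeRoots : Finset ↥D.peelData.amb := D.peelData.roots D.peelData.amb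

/-- **LSW's bijection `T ↦ γ(T)`, inverted: the Peano paths of `D ∈ 𝔇*` are in canonical
bijection with the spanning forests of `H(D)` rooted at `α`** (the spanning trees of `H`
containing `α`, oriented towards `α`). [cite: LawlerSchrammWerner2004, §4.1] -/
def peanoForestEquiv : PeanoPath D ≃ Forest D.treeGraph D.treeRoots :=
  D.peanoPathEquiv.trans
    (PeelData.Good.pathForestEquiv D.peelData D.good_peelData Finset.Subset.rfl)

/-- **The tree `T(γ)` of a Peano path of `D` consists of `α` and the primal edges alongside the
dual steps of `γ`** (those not already on `α`): LSW's `T = α_{ℓ+1}`, `α_{n+1} = α_n ∪ [v_n, v_{n+1}]`.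
[cite: LawlerSchrammWerner2004, §4.1] -/
theorem tEdge_peanoForestEquiv_iff (γ : PeanoPath D) (e : Sym2 (ℤ × ℤ)) :
    D.peelData.TEdge (D.peanoForestEquiv γ) e ↔ e ∈ PeelData.dualStepEdges γ.verts ∧ e ∉ edgeSet D.α :=
  PeelData.Good.tEdge_pathForestEquiv_iff D.peelData D.good_peelData Finset.Subset.rfl
    (D.peanoPathEquiv γ) e

/-- `H(D)` has a spanning forest rooted at `α` (the tree of any Peano path). [folklore] -/
instance nonempty_forest : Nonempty (Forest D.treeGraph D.treeRoots) :=
  let ⟨_, hl⟩ := D.good_peelData.exists_isPath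
  ⟨D.peanoForestEquiv (D.peanoPath hl)⟩

/-- **Every vertex of `H(D)` off `α` is joined to `α` in `H(D)`.** [folklore] -/
theorem reachesRoot_treeGraph : Forest.ReachesRoot D.treeGraph D.treeRoots :=
  Forest.reachesRoot_of_forest (Classical.choice D.nonempty_forest)

/-- **The UST Peano path law is the uniform spanning tree**: for every set `A` of spanning
forests of `H(D)` rooted at `α`, the `ustLaw D`-probability that `T(γ) ∈ A` is the uniform
(wired at `α`) spanning-forest probability of `A` ("when `T` is the UST on `H` conditioned to
contain `α`, `γ` is uniformly distributed among such Peano paths", read backwards along the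
bijection). [cite: LawlerSchrammWerner2004, §4.1] -/
theorem ustLaw_preimage_peanoForestEquiv (A : Set (Forest D.treeGraph D.treeRoots)) :
    ustLaw D (D.peanoForestEquiv ⁻¹' A) = Forest.ust D.treeGraph D.treeRoots A :=
  uniformOn_univ_preimage_equiv D.peanoForestEquiv A

/-- **The UST Peano path law is the uniform spanning tree** (push-forward form).
[cite: LawlerSchrammWerner2004, §4.1] -/
theorem map_peanoForestEquiv_ustLaw :
    (ustLaw D).map D.peanoForestEquiv = Forest.ust D.treeGraph D.treeRoots :=
  map_equiv_uniformOn_univ D.peanoForestEquiv fun _ _ ↦ trivial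

/-- **"By Wilson's algorithm"** ([LSW04] proof of Thm. 4.4, p. 975), general form: under the UST
Peano path law of `D`, the branch of the tree `T(γ)` from a vertex `v ∉ α` of `H(D)` to `α` is
distributed as the loop erasure of simple random walk on `H(D)` from `v` stopped on hitting
`α` — for any property `P` of paths. [cite: LawlerSchrammWerner2004, Theorem 4.4 (proof, p. 975)] -/
theorem ustLaw_br_pred_eq {v : ↥D.peelData.amb} (hv : v ∉ D.treeRoots)
    (P : List ↥D.peelData.amb → Prop) :
    ustLaw D {γ | P ((D.peanoForestEquiv γ).br v)} =
      wsum (Forest.srw D.treeGraph) v (fun t => IsStoppedAt (↑D.treeRoots : Set _) (v :: t) ∧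
        P (loopErase (afterLast v t))) := by
  rw [← Forest.ust_br_pred_eq D.reachesRoot_treeGraph hv P, ← ustLaw_preimage_peanoForestEquiv]
  rfl

/-- **"By Wilson's algorithm, `P[A]` is the probability that a simple random walk on `H(∂D)`
started at `v₀` stopped on hitting `α` will cross `A′₁`"** ([LSW04] proof of Thm. 4.4, p. 975),
in the entrance-edge form: under the UST Peano path law of `D`, the probability that the branch
of `T(γ)` from `v ∉ α` enters `α` through the edge `x → r` equals the probability that simple
random walk on `H(D)` from `v`, stopped on hitting `α`, enters through `x → r`.
[cite: LawlerSchrammWerner2004, Theorem 4.4 (proof, p. 975)] -/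
theorem ustLaw_br_endsWith_eq {v : ↥D.peelData.amb} (hv : v ∉ D.treeRoots)
    (x r : ↥D.peelData.amb) :
    ustLaw D {γ | Forest.EndsWith x r (v :: (D.peanoForestEquiv γ).br v)} =
      wsum (Forest.srw D.treeGraph) v (fun t => IsStoppedAt (↑D.treeRoots : Set _) (v :: t) ∧
        Forest.EndsWith x r (v :: t)) := by
  rw [← Forest.ust_br_endsWith_eq D.reachesRoot_treeGraph hv x r,
    ← ustLaw_preimage_peanoForestEquiv]
  rfl

end Domain

end USTPeano

end Literature.Probability.RandomPlanarGeometry
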